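/-
Copyright (c) 2026 the pub-hodgecm-mathlib formalisation cell (harness21).  Prover seat hodgecm-mathlib-K2E3-p12 (g4), Track B «K2-LIT» ∕ h413
(`stmt-HodgeConjecture-24833`), line `K2_E3_EllipticInputs`, unit U12-d, §L (G⁺-orb, rider): THE CLASS SETS `Sₐ = chart⁻¹(𝒪ₐ)` IN THE `(k, t)` CHART.  2026-09-04.
-/
import Summits.HodgeConjecture.HodgeConjecture.Theorems.K2E3GL2NilpotentOrbitsDetClass   -- ★ p857116 (this seat): `𝒪ₐ = Ad(det⁻¹D)·aE₁₂`, `nilp_mem_orbit_detSubgroup_nilp_iff`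
import HarnessLib

/-!
# K2_E3 road (h413), §L — (G⁺-orb, rider): `chart(k,t) ∈ 𝒪ₐ ⟺ t ≠ 0 ∧ a⁻¹·t·det k ∈ D`

Cell `pub/hodgecm-mathlib` (D-0151), Track B, seat K2E3-p12 (g4), §L line lead.  `--supports stmt-HodgeConjecture-24833 --as helper`; count-neutral plumbing for the
(G⁺-b) hands (K2E5-p17 (g3) line side, K2E5-p10 (g4) K-side), who integrate over the class sets `Sₐ` of ★ p857116 ∕ ★ p857331 in the chart `(k, t) ↦ k·tE₁₂·k⁻¹`.

* `conjNilp_eq_conj_nilpOne` — `k·(tE₁₂)·k⁻¹ = (k·d_t)·E₁₂·(k·d_t)⁻¹`, `d_t = diag(t,1)`, `det(k d_t) = det k · t` (★ `exists_diag_conj_nilpOne`).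
* **`conjNilp_mem_orbit_detSubgroup_iff`** — for `D ⊇ (Fˣ)²`, `k ∈ GL₂(F)`, `t ∈ F`, `a ∈ Fˣ`: `k·tE₁₂·k⁻¹ ∈ Ad(det⁻¹D)·(aE₁₂) ⟺ ∃ (h : t ≠ 0), a⁻¹·(t·det k) ∈ D`.
* **`setOf_chart_mem_orbit_eq`** — the class set of ★ p857116∕p857331 as `{p : GL₂(𝒪) × F | ∃ h : p.2 ≠ 0, a⁻¹·(p.2·det p.1) ∈ D}`.

HONEST LABEL: HC_CM is proved only modulo the 7 printed citations (2 remaining named inputs: hLiu418 = stmt-HodgeConjecture-24832, h413 = stmt-HodgeConjecture-24833)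
until rung 0 closes; count-neutral plumbing.

References: [HarishChandra1999AdmissibleDistributions] Harish-Chandra (DeBacker–Sally) (1999), §3 p. 8, Lemma 5.2; [BernsteinZelevinsky1976] Bernstein–Zelevinsky (1976), §1.18.
-/

set_option autoImplicit false
set_option linter.dupNamespace false   -- `Summit.HodgeConjecture.HodgeConjecture.…` (D-0017 nested layout; lakefile exemption for Summits)

open scoped MatrixGroups
open Literature.NumberTheory.Automorphic
open Summit.HodgeConjecture.HodgeConjecture.Cruxes.H413.K2E3GL2RegularNilpotentOrbitSpace
open Summit.HodgeConjecture.HodgeConjecture.Cruxes.H413.K2E3GL2RegularNilpotentOrbitPushforward (conjNilp_eq_zero_iff)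
open Summit.HodgeConjecture.HodgeConjecture.Cruxes.H413.K2E3GL2NilpotentSubgroupOrbitSpace (orbit_subgroup_subset)
open Summit.HodgeConjecture.HodgeConjecture.Cruxes.H413.K2E3GL2NilpotentOrbitsDetClass

namespace Summit.HodgeConjecture.HodgeConjecture.Cruxes.H413.K2E3GL2NilpotentOrbitsDetClassChart

variable {F : Type*} [Field F] (D : Subgroup Fˣ)

/-- **`k·(tE₁₂)·k⁻¹ = g·E₁₂·g⁻¹` with `det g = det k · t`** (`g = k·diag(t,1)`), `t ∈ Fˣ`. [cite: HarishChandra1999AdmissibleDistributions, §3 p. 8] -/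
theorem conjNilp_eq_conj_nilpOne (k : GL (Fin 2) F) (t : Fˣ) :
    ∃ g : GL (Fin 2) F, Matrix.GeneralLinearGroup.det g = Matrix.GeneralLinearGroup.det k * t ∧
      (k : Matrix (Fin 2) (Fin 2) F) * !![0, (t : F); 0, 0] * ((k⁻¹ : GL (Fin 2) F) : Matrix (Fin 2) (Fin 2) F) =
        (g : Matrix (Fin 2) (Fin 2) F) * !![0, 1; 0, 0] * ((g⁻¹ : GL (Fin 2) F) : Matrix (Fin 2) (Fin 2) F) := by
  obtain ⟨d, hdd, hd⟩ := exists_diag_conj_nilpOne (F := F) t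
  refine ⟨k * d, ?_, ?_⟩
  · apply Units.ext
    simp only [map_mul, Units.val_mul, Matrix.GeneralLinearGroup.val_det_apply, hdd]
  · rw [← hd, units_conj_conj]

/-- **CLASS MEMBERSHIP IN THE CHART**: for `D ⊇ (Fˣ)²`, `k·tE₁₂·k⁻¹ ∈ 𝒪ₐ = Ad(det⁻¹D)·aE₁₂ ⟺ t ≠ 0 ∧ a⁻¹·(t·det k) ∈ D` — ★ `mem_orbit_detSubgroup_nilp_det` puts
`k·tE₁₂·k⁻¹` in `𝒪_{t·det k}`, and ★ `nilp_mem_orbit_detSubgroup_nilp_iff` compares classes. [cite: HarishChandra1999AdmissibleDistributions, §3 p. 8, Lemma 5.2]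
[cite: BernsteinZelevinsky1976, §1.18] -/
theorem conjNilp_mem_orbit_detSubgroup_iff (hD2 : ∀ u : Fˣ, u * u ∈ D) (k : GL (Fin 2) F) (t : F) (a : Fˣ) :
    (k : Matrix (Fin 2) (Fin 2) F) * !![0, t; 0, 0] * ((k⁻¹ : GL (Fin 2) F) : Matrix (Fin 2) (Fin 2) F) ∈
        MulAction.orbit ↥((D.comap (Matrix.GeneralLinearGroup.det : GL (Fin 2) F →* Fˣ)).comap
          (ConjAct.ofConjAct : ConjAct (GL (Fin 2) F) ≃* GL (Fin 2) F).toMonoidHom) (!![0, (a : F); 0, 0] : Matrix (Fin 2) (Fin 2) F) ↔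
      ∃ ht : t ≠ 0, a⁻¹ * (Units.mk0 t ht * Matrix.GeneralLinearGroup.det k) ∈ D := by
  constructor
  · intro h
    have ht : t ≠ 0 := by
      intro ht0
      have h0 : (k : Matrix (Fin 2) (Fin 2) F) * !![0, t; 0, 0] * ((k⁻¹ : GL (Fin 2) F) : Matrix (Fin 2) (Fin 2) F) = 0 :=
        (conjNilp_eq_zero_iff k t).2 ht0
      rw [h0] at h
      -- `0` is not in the orbit of the non-zero nilpotent `aE₁₂`
      have hsub := orbit_subgroup_subset
        ((D.comap (Matrix.GeneralLinearGroup.det : GL (Fin 2) F →* Fˣ)).comap (ConjAct.ofConjAct : ConjAct (GL (Fin 2) F) ≃* GL (Fin 2) F).toMonoidHom)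
        (isNilpotent_nilp_and_ne_zero a).1 (isNilpotent_nilp_and_ne_zero a).2 h
      exact ((mem_orbit_nilpOne_iff _).1 hsub).2 rfl
    refine ⟨ht, ?_⟩
    obtain ⟨g, hgdet, hg⟩ := conjNilp_eq_conj_nilpOne k (Units.mk0 t ht)
    rw [Units.val_mk0] at hg
    rw [hg] at h
    have hmem := mem_orbit_detSubgroup_nilp_det D g
    -- both `aE₁₂`-orbit and `(det g)E₁₂`-orbit contain `g E₁₂ g⁻¹`: the classes agree
    have heq : MulAction.orbit _ (!![0, (a : F); 0, 0] : Matrix (Fin 2) (Fin 2) F) =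
        MulAction.orbit ↥((D.comap (Matrix.GeneralLinearGroup.det : GL (Fin 2) F →* Fˣ)).comap
          (ConjAct.ofConjAct : ConjAct (GL (Fin 2) F) ≃* GL (Fin 2) F).toMonoidHom)
          (!![0, ((Matrix.GeneralLinearGroup.det g : Fˣ) : F); 0, 0] : Matrix (Fin 2) (Fin 2) F) :=
      ((MulAction.orbit_eq_iff.2 h).symm).trans (MulAction.orbit_eq_iff.2 hmem)
    have : (!![0, ((Matrix.GeneralLinearGroup.det g : Fˣ) : F); 0, 0] : Matrix (Fin 2) (Fin 2) F) ∈
        MulAction.orbit ↥((D.comap (Matrix.GeneralLinearGroup.det : GL (Fin 2) F →* Fˣ)).comap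
          (ConjAct.ofConjAct : ConjAct (GL (Fin 2) F) ≃* GL (Fin 2) F).toMonoidHom) (!![0, (a : F); 0, 0] : Matrix (Fin 2) (Fin 2) F) := by
      rw [heq]; exact MulAction.mem_orbit_self _
    rw [nilp_mem_orbit_detSubgroup_nilp_iff D hD2] at this
    rwa [hgdet, mul_comm (Matrix.GeneralLinearGroup.det k)] at this
  · rintro ⟨ht, hmem⟩
    obtain ⟨g, hgdet, hg⟩ := conjNilp_eq_conj_nilpOne k (Units.mk0 t ht)
    rw [Units.val_mk0] at hg
    rw [hg]
    have h1 := mem_orbit_detSubgroup_nilp_det D g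
    have h2 : (!![0, ((Matrix.GeneralLinearGroup.det g : Fˣ) : F); 0, 0] : Matrix (Fin 2) (Fin 2) F) ∈
        MulAction.orbit ↥((D.comap (Matrix.GeneralLinearGroup.det : GL (Fin 2) F →* Fˣ)).comap
          (ConjAct.ofConjAct : ConjAct (GL (Fin 2) F) ≃* GL (Fin 2) F).toMonoidHom) (!![0, (a : F); 0, 0] : Matrix (Fin 2) (Fin 2) F) := by
      rw [nilp_mem_orbit_detSubgroup_nilp_iff D hD2, hgdet, mul_comm (Matrix.GeneralLinearGroup.det k)]
      exact hmem
    exact (MulAction.orbit_eq_iff.2 h2) ▸ h1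

/-- **THE CLASS SET IN THE CHART**: `{p : GL₂(𝒪) × F | chart p ∈ 𝒪ₐ} = {p | ∃ h : p.2 ≠ 0, a⁻¹·(p.2·det p.1) ∈ D}` (the sets ★ p857116 ∕ ★ p857331 integrate over).
[cite: HarishChandra1999AdmissibleDistributions, Lemma 5.2] -/
theorem setOf_chart_mem_orbit_eq [ValuativeRel F] [TopologicalSpace F] [IsNonarchimedeanLocalField F] (hD2 : ∀ u : Fˣ, u * u ∈ D) (a : Fˣ) :
    {p : ↥(glInt 2 F) × F | ((p.1 : GL (Fin 2) F) : Matrix (Fin 2) (Fin 2) F) * !![0, p.2; 0, 0] *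
        ((((p.1 : GL (Fin 2) F))⁻¹ : GL (Fin 2) F) : Matrix (Fin 2) (Fin 2) F) ∈
          MulAction.orbit ↥((D.comap (Matrix.GeneralLinearGroup.det : GL (Fin 2) F →* Fˣ)).comap
            (ConjAct.ofConjAct : ConjAct (GL (Fin 2) F) ≃* GL (Fin 2) F).toMonoidHom) (!![0, (a : F); 0, 0] : Matrix (Fin 2) (Fin 2) F)} =
      {p : ↥(glInt 2 F) × F | ∃ ht : p.2 ≠ 0, a⁻¹ * (Units.mk0 p.2 ht * Matrix.GeneralLinearGroup.det (p.1 : GL (Fin 2) F)) ∈ D} := by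
  ext p
  exact conjNilp_mem_orbit_detSubgroup_iff D hD2 (p.1 : GL (Fin 2) F) p.2 a

end Summit.HodgeConjecture.HodgeConjecture.Cruxes.H413.K2E3GL2NilpotentOrbitsDetClassChart
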